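import Summits.BirchSwinnertonDyer.Rank1Residual.X11a.LeafMainConjecture
import Summits.BirchSwinnertonDyer.Rank1Residual.X11a.MainConjectureHeightFree
import HarnessLib

/-!
# Class X11a: the located gap in exact kernel form — "Mazur's main conjecture at the pair ⟺ `BSD(E,p)`"
# and the class statement of record — with the height-existence facts DISCHARGED (cell `b2b-bsdres`, unit `b2b-bsdres-x11a`, gen 18)

HONEST FRAMING (run/shared/lean/b2b/bsd-rank1-residual/, verbatim in every file): the goal of the
cell is to DELETE the COMBINATION-SHAPED residual classes of the Birch–Swinnerton-Dyer formula for
ALL analytic-rank `≤ 1` elliptic curves over `ℚ` — "full BSD formula for every rank `≤ 1` curve in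
class `C`" assembled STRICTLY from published theorems — so that the rank-`≤ 1` remainder becomes
exactly the CONSTRUCTION-SHAPED classes, which are TYPED (missing-input `Prop`s), NOT attempted.
This is not "finishing BSD". Research route; NO CLAIM BEYOND STATED CLASSES. No label change is
made by this file (cell lead / referee).

Height-free twins (`…_heightFree`) of the equivalences of `X11a/MainConjectureCertificates.lean`
(gen 13) and `X11a/LeafMainConjecture.lean` (gen 13): at a multiplicative `p ≥ 5` with surjective
`ρ̄_{E,p}` and analytic rank `0`, `X2.MazurMainConjectureAt W p ↔ BSDp W p ↔ MissingLowerBoundAt W p`;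
the class-level forms; Mazur's main conjecture at the pair from Wuthrich Prop. 21 (`p ∤ #Ш_an`) or
from one unit Kurihara number (Kim AJM 2026); the leaf target ⟺ [MC at every surjective leaf pair] ∧
[`BSD(E,p)` at every non-surjective leaf pair]; `target_iff_final_heightFree` (the class statement
of record, final shape); the semistable restatement.  In every one the binders
`hHs : SteinWuthrich2013.exists_isSplitMultCanonical` / `hHn : exists_isMultCanonical` are GONE:
both directions of the rank-`0` glue are height-free (`X2.…_heightFree`, p225969;
`mazurMainConjectureAt_of_bsdp_heightFree`, `X11a/MainConjectureHeightFree.lean`) because THE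
Stein–Wuthrich §4.2 datum on a finite `E(ℚ)` is the zero pairing.  Statements otherwise
byte-identical to the originals; proofs are the originals' one-liners re-pointed.  The remaining
binders are NAMED PUBLISHED facts only: Kato–Wuthrich A32 (`hKato`), Stein–Wuthrich Thm. 6.1 ×2
(`hJs`, `hJn`), GZK (`hGZK`), modularity (`hmod`, `hpar`), Greenberg–Stevens (`hGS`), and where
stated Wuthrich Prop. 21 (`hWu`), Kim Thm. 1.8 (6) (`hKim`) with the period transfer (`hϖ`).

References: [GreenbergLNM1716] §4–5; [Wuthrich2014] Thm. 3, Cor. 19, Prop. 21; [SteinWuthrich2013]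
Thm. 6.1, §4.2; [Skinner2016PacificMC] Thm. A; [Kim2022StructureSelmer] Thm. 1.9; [Miller2011LMS] Def. 1.1;
[Serre1972] §5.4 Prop. 21.
-/

set_option autoImplicit false

noncomputable section

open scoped Classical MatrixGroups ModularForm

open CongruenceSubgroup WeierstrassCurve Literature.NumberTheory.EllipticCurves
  Literature.NumberTheory.EllipticCurves.ModularForms
  Literature.NumberTheory.EllipticCurves.Rank1Residual
  Literature.NumberTheory.EllipticCurves.Rank1Residual.Typed
  Literature.NumberTheory.EllipticCurves.Wuthrich2014
  Literature.NumberTheory.EllipticCurves.SteinWuthrich2013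

namespace Summit.BirchSwinnertonDyer.Rank1Residual.X11a

/-! ### The equivalences -/

/-- **At a multiplicative `p ≥ 5` with surjective `ρ̄_{E,p}` and `ord_{s=1}L(E,s) = 0`:
Mazur's main conjecture at `(E,p)` ⟺ `BSD(E,p)`** (⇒: eisenstein-p2 / x11a gen 8 glue
`X2.bsdp_of_mazurMainConjectureAt_of_analyticRank_eq_zero`, needing modularity with a newform
datum `hpar`; ⇐: `mazurMainConjectureAt_of_bsdp`). On X11a's surjective leaf the typed missing input
is therefore EXACT. [cite: GreenbergLNM1716, §4 (PDF pp. 112–113) and §5 (closing examples)]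
[cite: SteinWuthrich2013, Thm. 6.1 (p. 20)] [cite: Wuthrich2014, Thm. 3 (p. 382) and Cor. 19 proof (p. 399)] -/
theorem mazurMainConjectureAt_iff_bsdp_heightFree
    (hKato : kato_charIdeal_dvd_multiplicative_of_surjective)
    (hJs : thm61_splitMultiplicative) (hJn : thm61_nonsplitMultiplicative)
    (hGZK : rank_eq_analyticRank_of_analyticRank_le_one) (hmod : hasEntireLFunction_rat)
    (hpar : nonempty_modularParametrizationData)
    (W : WeierstrassCurve ℚ) [W.IsElliptic] [W.IsGloballyMinimal] (p : ℕ) [Fact p.Prime]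
    (hGS : greenberg_stevens (W := W) (p := p))
    (hp : 5 ≤ p) (hmult : W.HasMultiplicativeReductionAtPrime p)
    (hsurj : W.HasSurjectiveModNGaloisRep p) (hr : W.analyticRank = 0) :
    X2.MazurMainConjectureAt W p ↔ BSDp W p :=
  ⟨X2.bsdp_of_mazurMainConjectureAt_of_analyticRank_eq_zero_heightFree hJs hJn hGZK hmod hpar W p
      hGS
      (by omega) hmult hr,
    mazurMainConjectureAt_of_bsdp_heightFree hKato hJs hJn hGZK hmod W p hGS hp hmult hsurj hr⟩

/-- **The same with the typed LOWER bound on the right** (`ord_p #Ш_an ≤ ord_p #Ш`,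
`Typed.MissingLowerBoundAt`): at such a pair the three statements — main conjecture, `BSD(E,p)`,
lower bound — coincide (the upper bound half of `BSD(E,p)` comes with it).
[cite: Wuthrich2014, Prop. 21 (p. 400)] [cite: GreenbergLNM1716, §4 (PDF pp. 112–113)] -/
theorem mazurMainConjectureAt_iff_missingLowerBoundAt_heightFree
    (hKato : kato_charIdeal_dvd_multiplicative_of_surjective)
    (hJs : thm61_splitMultiplicative) (hJn : thm61_nonsplitMultiplicative)
    (hGZK : rank_eq_analyticRank_of_analyticRank_le_one) (hmod : hasEntireLFunction_rat)
    (hpar : nonempty_modularParametrizationData)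
    (W : WeierstrassCurve ℚ) [W.IsElliptic] [W.IsGloballyMinimal] (p : ℕ) [Fact p.Prime]
    (hGS : greenberg_stevens (W := W) (p := p))
    (hp : 5 ≤ p) (hmult : W.HasMultiplicativeReductionAtPrime p)
    (hsurj : W.HasSurjectiveModNGaloisRep p) (hr : W.analyticRank = 0) :
    X2.MazurMainConjectureAt W p ↔ MissingLowerBoundAt W p := by
  constructor
  · intro hMC
    haveI : Finite W.sha := (hGZK W (by rw [hr]; exact zero_le_one)).2
    exact (lower_and_upper_of_missingPPartAt W p (missingPPartAt_of_bsdp W p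
      (X2.bsdp_of_mazurMainConjectureAt_of_analyticRank_eq_zero_heightFree hJs hJn hGZK hmod hpar
        W p hGS
        (by omega) hmult hr hMC))).1
  · exact mazurMainConjectureAt_of_missingLowerBoundAt_heightFree hKato hJs hJn hGZK hmod W p hGS hp
      hmult hsurj hr

/-- **Class level, surjective image: "`BSD(E,p)` at every X11a pair with `p ≥ 5` and `ρ̄`
surjective" ⟺ "Mazur's main conjecture at every such pair"** (same facts). Neither side is in
print at the très-ramifié pairs with `p ∣ #Ш_an`; this says the missing object is EXACTLY the
(ram)-free cyclotomic main conjecture at `p ‖ N` in analytic rank `0`.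
[cite: GreenbergLNM1716, §4 (PDF pp. 112–113) and §5 (closing examples)]
[cite: Skinner2016PacificMC, Thm. A (§1) (hypothesis (iii) = (ram))] -/
theorem forall_mazurMainConjectureAt_iff_forall_bsdp_heightFree
    (hKato : kato_charIdeal_dvd_multiplicative_of_surjective)
    (hJs : thm61_splitMultiplicative) (hJn : thm61_nonsplitMultiplicative)
    (hGZK : rank_eq_analyticRank_of_analyticRank_le_one) (hmod : hasEntireLFunction_rat)
    (hpar : nonempty_modularParametrizationData)
    (hGS : ∀ (W : WeierstrassCurve ℚ) [W.IsElliptic] [W.IsGloballyMinimal] (p : ℕ) [Fact p.Prime],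
      greenberg_stevens (W := W) (p := p)) :
    (∀ (W : WeierstrassCurve ℚ) [W.IsElliptic] [W.IsGloballyMinimal] (p : ℕ) [Fact p.Prime],
      ClassX11a W p → 5 ≤ p → Surj W p → X2.MazurMainConjectureAt W p) ↔
    (∀ (W : WeierstrassCurve ℚ) [W.IsElliptic] [W.IsGloballyMinimal] (p : ℕ) [Fact p.Prime],
      ClassX11a W p → 5 ≤ p → Surj W p → BSDp W p) := by
  constructor
  · intro h W _ _ p _ hX hp hsurj
    exact (mazurMainConjectureAt_iff_bsdp_heightFree hKato hJs hJn hGZK hmod hpar W p (hGS W p) hp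
      hX.2.2.1 hsurj hX.1).mp (h W p hX hp hsurj)
  · intro h W _ _ p _ hX hp hsurj
    exact (mazurMainConjectureAt_iff_bsdp_heightFree hKato hJs hJn hGZK hmod hpar W p (hGS W p) hp
      hX.2.2.1 hsurj hX.1).mpr (h W p hX hp hsurj)

/-! ### Per-pair main-conjecture certificates from the published record -/

/-- **Mazur's main conjecture at every rank-`0`, `p ≥ 5`, `p ‖ N`, `ρ̄`-surjective pair with
`p ∤ #Ш(E/ℚ)_an` — WITHOUT (ram).** Wuthrich 2014 Prop. 21 (`hWu`) closes `BSD(E,p)` there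
(x11a gen 1 `Wuthrich2014.bsdp_of_L_one_ne_zero_of_padicValRat_shaAn_eq_zero`), and the converse
chain turns it into the main conjecture at the pair. Census: 613 of the 615 rank-`0` X11-type pairs
`N < 2·10⁴` at `p ≥ 5`; e.g. every multiplicative `p ≥ 5` of a rank-`0` curve with `#Ш_an = 1` and
surjective `ρ̄_{E,p}`. [cite: Wuthrich2014, Prop. 21 (p. 400) and Cor. 19 proof (p. 399)]
[cite: GreenbergLNM1716, §4 (PDF pp. 112–113) and §5 (closing examples)] -/
theorem mazurMainConjectureAt_of_shaAn_unit_heightFree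
    (hKato : kato_charIdeal_dvd_multiplicative_of_surjective) (hWu : sha_dvd_analyticSha)
    (hJs : thm61_splitMultiplicative) (hJn : thm61_nonsplitMultiplicative)
    (hGZK : rank_eq_analyticRank_of_analyticRank_le_one) (hmod : hasEntireLFunction_rat)
    (W : WeierstrassCurve ℚ) [W.IsElliptic] [W.IsGloballyMinimal] (p : ℕ) [Fact p.Prime]
    (hGS : greenberg_stevens (W := W) (p := p))
    (hp : 5 ≤ p) (hmult : W.HasMultiplicativeReductionAtPrime p)
    (hsurj : W.HasSurjectiveModNGaloisRep p) (hr : W.analyticRank = 0)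
    (hunit : ∃ q : ℚ, shaAn W = (q : ℂ) ∧ padicValRat p q = 0) :
    X2.MazurMainConjectureAt W p :=
  mazurMainConjectureAt_of_bsdp_heightFree hKato hJs hJn hGZK hmod W p hGS hp hmult hsurj hr
    (Wuthrich2014.bsdp_of_L_one_ne_zero_of_padicValRat_shaAn_eq_zero hWu hGZK W p (by omega)
      ((W.analyticRank_eq_zero_iff_holds (hmod W)).1 hr)
      (WeierstrassCurve.HasMultiplicativeReduction.not_hasAdditiveReduction _ hmult) (Or.inr hsurj)
      hunit)

/-- **Mazur's main conjecture at `(E,p)` from ONE unit Kurihara number** (X11 ∧ `r = 0`, `p ≥ 5`,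
`ρ̄` surjective, `p ∤ ∏c_ℓ·#E(ℚ)_tors`): Kim, Amer. J. Math. 148 (2026) Thm. 1.8 (6) (`hKim`) with
the period transfer at `p ‖ N` (`hϖ`) closes `BSD(E,p)` (gen 12
`X11RankZero.bsdp_of_kim_of_kuriharaNumber_ne_zero`), and the converse chain gives the main
conjecture. Instances: `10580l1@5` (`δ̃_{251·281} ≡ 2`), `17640l1@5` (`δ̃_{101·131} ≡ 1`) — rank `0`,
`#Ш_an = 25`, très ramifié, NO (ram) prime: outside Skinner 2016 Thm. A — and 141 further pairs
`N < 5·10⁵` (REPORT-g12). [cite: Kim2022StructureSelmer, Thm. 1.9 (6) (PDF p. 8), Cor. 1.6]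
[cite: GreenbergLNM1716, §4 (PDF pp. 112–113) and §5 (closing examples)] -/
theorem mazurMainConjectureAt_of_kim_heightFree
    (hKato : kato_charIdeal_dvd_multiplicative_of_surjective)
    (hKim : Kim2022_rankZero_padicValRat_sha_of_kuriharaNumber_ne_zero)
    (hϖ : realPeriodRat_eq_unit_mul_plusPeriod_of_multiplicative)
    (hJs : thm61_splitMultiplicative) (hJn : thm61_nonsplitMultiplicative)
    (hGZK : rank_eq_analyticRank_of_analyticRank_le_one) (hmod : hasEntireLFunction_rat)
    (W : WeierstrassCurve ℚ) [W.IsElliptic] [W.IsGloballyMinimal] (p : ℕ) [Fact p.Prime]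
    (hGS : greenberg_stevens (W := W) (p := p))
    (hp : 5 ≤ p) (hr : W.analyticRank = 0) (hX : ClassX11 W p) (hsurj : Surj W p)
    (htam : ¬ p ∣ W.tamagawaProduct) (htors : ¬ p ∣ W.torsionOrder)
    {N : ℕ} [NeZero N] (f : CuspForm (Gamma0 N) 2) (hf : IsNewformOf W f)
    (n : ℕ) [NeZero n] (hn : Kato.IsKolyvaginProduct W p 1 n)
    (hcyc : ∀ (ℓ : ℕ) [Fact ℓ.Prime], ℓ ∣ n →
      Nat.card {P : ((WeierstrassCurve.integralModelInt W).map
          (Int.castRingHom (ZMod ℓ))).toAffine.Point // p • P = 0} ≤ p)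
    (ψ : (ℓ : ℕ) → (ZMod ℓ)ˣ →* Multiplicative (ZMod (p ^ 1)))
    (hψ : ∀ ℓ ∈ n.primeFactors, Function.Surjective (ψ ℓ))
    (hδ : kuriharaNumber f (p ^ 1) n ψ ≠ 0) : X2.MazurMainConjectureAt W p :=
  mazurMainConjectureAt_of_bsdp_heightFree hKato hJs hJn hGZK hmod W p hGS hp hX.1 hsurj hr
    (X11RankZero.bsdp_of_kim_of_kuriharaNumber_ne_zero W p hKim hϖ hGZK hmod hp hr hX hsurj htam
      htors f hf n hn hcyc ψ hψ hδ)

section Leaf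

variable {W : WeierstrassCurve ℚ} [W.IsElliptic] [W.IsGloballyMinimal] {p : ℕ} [Fact p.Prime]

/-! ### The typed input is exact on the surjective leaf; the published sub-cell proves it -/

/-- **On the surjective part of the leaf the typed missing input is EXACT**: at a leaf pair with
`ρ̄_{E,p}` surjective, `X2.MazurMainConjectureAt W p ↔ BSDp W p` (companion
`mazurMainConjectureAt_iff_bsdp`). [cite: GreenbergLNM1716, §4 (PDF pp. 112–113) and §5 (closing examples)]
[cite: Wuthrich2014, Thm. 3 (p. 382) and Cor. 19 proof (p. 399)] -/
theorem Leaf.mazurMainConjectureAt_iff_bsdp_heightFree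
    (hKato : kato_charIdeal_dvd_multiplicative_of_surjective)
    (hJs : thm61_splitMultiplicative) (hJn : thm61_nonsplitMultiplicative)
    (hGZK : rank_eq_analyticRank_of_analyticRank_le_one) (hmod : hasEntireLFunction_rat)
    (hpar : nonempty_modularParametrizationData)
    (hGS : greenberg_stevens (W := W) (p := p)) (h : Leaf W p) (hsurj : Surj W p) :
    X2.MazurMainConjectureAt W p ↔ BSDp W p :=
  X11a.mazurMainConjectureAt_iff_bsdp_heightFree hKato hJs hJn hGZK hmod hpar W p hGS h.five_le
    h.1.mult hsurj h.1.1

/-- **For a SEMISTABLE curve the whole leaf is exact** (surjectivity from Serre/Edixhoven).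
[cite: Serre1972, §5.4 Prop. 21 i)] [cite: GreenbergLNM1716, §4 (PDF pp. 112–113) and §5 (closing examples)] -/
theorem Leaf.mazurMainConjectureAt_iff_bsdp_of_semistable_heightFree
    (hKato : kato_charIdeal_dvd_multiplicative_of_surjective)
    (hJs : thm61_splitMultiplicative) (hJn : thm61_nonsplitMultiplicative)
    (hGZK : rank_eq_analyticRank_of_analyticRank_le_one) (hmod : hasEntireLFunction_rat)
    (hpar : nonempty_modularParametrizationData)
    (hGS : greenberg_stevens (W := W) (p := p)) (h : Leaf W p) (hsst : Semistable W) :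
    X2.MazurMainConjectureAt W p ↔ BSDp W p :=
  h.mazurMainConjectureAt_iff_bsdp_heightFree hKato hJs hJn hGZK hmod hpar hGS
    (h.surj_of_semistable hsst)

/-- **On the PUBLISHED sub-cell Mazur's main conjecture at `(E,p)` is a theorem of the published
record** (Wuthrich Prop. 21 `hWu` ⇒ `BSD(E,p)` ⇒ main conjecture by the converse chain), with NO
(ram) prime — i.e. outside Skinner 2016 Thm. A. Census: 613 of 615 rank-`0` X11-type pairs at
`p ≥ 5`, `N < 2·10⁴`. [cite: Wuthrich2014, Prop. 21 (p. 400)]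
[cite: GreenbergLNM1716, §4 (PDF pp. 112–113) and §5 (closing examples)] -/
theorem CellPub.mazurMainConjectureAt_heightFree
    (hKato : kato_charIdeal_dvd_multiplicative_of_surjective) (hWu : sha_dvd_analyticSha)
    (hJs : thm61_splitMultiplicative) (hJn : thm61_nonsplitMultiplicative)
    (hGZK : rank_eq_analyticRank_of_analyticRank_le_one) (hmod : hasEntireLFunction_rat)
    (hGS : greenberg_stevens (W := W) (p := p)) (h : CellPub W p) : X2.MazurMainConjectureAt W p :=
  mazurMainConjectureAt_of_shaAn_unit_heightFree hKato hWu hJs hJn hGZK hmod W p hGS h.2.1 h.1.mult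
    h.2.2.1 h.1.1 h.2.2.2

/-! ### The leaf target and the class statement of record, final shape -/

/-- **The leaf target ⟺ [main conjecture at every SURJECTIVE leaf pair] ∧ [`BSD(E,p)` at every
NON-surjective leaf pair]** (published facts as binders). The first conjunct is X11a's located
gap in its exact form (nothing in print at a très-ramifié (ram)-free `p ‖ N` with `p ∣ #Ш_an`; every
census pair closed per pair); the second has no census pair (and no semistable member).
[cite: GreenbergLNM1716, §4 (PDF pp. 112–113) and §5 (closing examples)]
[cite: Skinner2016PacificMC, Thm. A (§1) (hypothesis (iii) = (ram))] -/
theorem targetLeaf_iff_of_published_heightFree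
    (hKato : kato_charIdeal_dvd_multiplicative_of_surjective)
    (hJs : thm61_splitMultiplicative) (hJn : thm61_nonsplitMultiplicative)
    (hGZK : rank_eq_analyticRank_of_analyticRank_le_one) (hmod : hasEntireLFunction_rat)
    (hpar : nonempty_modularParametrizationData)
    (hGS : ∀ (W : WeierstrassCurve ℚ) [W.IsElliptic] [W.IsGloballyMinimal] (p : ℕ) [Fact p.Prime],
      greenberg_stevens (W := W) (p := p)) :
    TargetLeaf ↔
      (∀ (W : WeierstrassCurve ℚ) [W.IsElliptic] [W.IsGloballyMinimal] (p : ℕ) [Fact p.Prime],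
        Leaf W p → Surj W p → X2.MazurMainConjectureAt W p) ∧
      (∀ (W : WeierstrassCurve ℚ) [W.IsElliptic] [W.IsGloballyMinimal] (p : ℕ) [Fact p.Prime],
        Leaf W p → ¬ Surj W p → BSDp W p) := by
  constructor
  · intro hT
    refine ⟨fun W _ _ p _ hL hsurj => ?_, fun W _ _ p _ hL _ => hT W p hL⟩
    exact (hL.mazurMainConjectureAt_iff_bsdp_heightFree hKato hJs hJn hGZK hmod hpar (hGS W p)
      hsurj).mpr (hT W p hL)
  · rintro ⟨hMC, hNS⟩ W _ _ p _ hL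
    by_cases hsurj : Surj W p
    · exact (hL.mazurMainConjectureAt_iff_bsdp_heightFree hKato hJs hJn hGZK hmod hpar (hGS W p)
        hsurj).mp (hMC W p hL hsurj)
    · exact hNS W p hL hsurj

/-- **The class statement of record for X11a, final shape**: granted the published facts,
`X11a.Target ⟺ TargetThree ∧ (∀ surjective leaf pair, Mazur's main conjecture at the pair) ∧
(∀ non-surjective leaf pair, BSD(E,p))` — the published sub-cell needs nothing (Wuthrich Prop. 21,
`hWu`). Each conjunct is OPEN at class level; this is the census-free statement of exactly what the
published record leaves of X11a. [cite: Wuthrich2014, Prop. 21 (p. 400)]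
[cite: GreenbergLNM1716, §4 (PDF pp. 112–113) and §5 (closing examples)] -/
theorem target_iff_final_heightFree
    (hKato : kato_charIdeal_dvd_multiplicative_of_surjective) (hWu : sha_dvd_analyticSha)
    (hJs : thm61_splitMultiplicative) (hJn : thm61_nonsplitMultiplicative)
    (hGZK : rank_eq_analyticRank_of_analyticRank_le_one) (hmod : hasEntireLFunction_rat)
    (hpar : nonempty_modularParametrizationData)
    (hGS : ∀ (W : WeierstrassCurve ℚ) [W.IsElliptic] [W.IsGloballyMinimal] (p : ℕ) [Fact p.Prime],
      greenberg_stevens (W := W) (p := p)) :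
    Target ↔
      TargetThree ∧
      (∀ (W : WeierstrassCurve ℚ) [W.IsElliptic] [W.IsGloballyMinimal] (p : ℕ) [Fact p.Prime],
        Leaf W p → Surj W p → X2.MazurMainConjectureAt W p) ∧
      (∀ (W : WeierstrassCurve ℚ) [W.IsElliptic] [W.IsGloballyMinimal] (p : ℕ) [Fact p.Prime],
        Leaf W p → ¬ Surj W p → BSDp W p) := by
  rw [target_iff_targetThree_and_targetLeaf hWu hGZK hmod,
    targetLeaf_iff_of_published_heightFree hKato hJs hJn hGZK hmod hpar hGS]

/-- **For SEMISTABLE curves the X11a statement at `p ≥ 5` IS Mazur's main conjecture on the leaf**: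
restricted to semistable `E`, "`BSD(E,p)` at every leaf pair" ⟺ "the main conjecture at every leaf
pair" (no image hypothesis: Serre/Edixhoven). [cite: Serre1972, §5.4 Prop. 21 i)]
[cite: GreenbergLNM1716, §4 (PDF pp. 112–113) and §5 (closing examples)] -/
theorem forall_semistable_leaf_bsdp_iff_mazurMainConjectureAt_heightFree
    (hKato : kato_charIdeal_dvd_multiplicative_of_surjective)
    (hJs : thm61_splitMultiplicative) (hJn : thm61_nonsplitMultiplicative)
    (hGZK : rank_eq_analyticRank_of_analyticRank_le_one) (hmod : hasEntireLFunction_rat)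
    (hpar : nonempty_modularParametrizationData)
    (hGS : ∀ (W : WeierstrassCurve ℚ) [W.IsElliptic] [W.IsGloballyMinimal] (p : ℕ) [Fact p.Prime],
      greenberg_stevens (W := W) (p := p)) :
    (∀ (W : WeierstrassCurve ℚ) [W.IsElliptic] [W.IsGloballyMinimal] (p : ℕ) [Fact p.Prime],
        Semistable W → Leaf W p → BSDp W p) ↔
    (∀ (W : WeierstrassCurve ℚ) [W.IsElliptic] [W.IsGloballyMinimal] (p : ℕ) [Fact p.Prime],
        Semistable W → Leaf W p → X2.MazurMainConjectureAt W p) := by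
  constructor
  · intro h W _ _ p _ hsst hL
    exact (hL.mazurMainConjectureAt_iff_bsdp_of_semistable_heightFree hKato hJs hJn hGZK hmod hpar
      (hGS W p) hsst).mpr (h W p hsst hL)
  · intro h W _ _ p _ hsst hL
    exact (hL.mazurMainConjectureAt_iff_bsdp_of_semistable_heightFree hKato hJs hJn hGZK hmod hpar
      (hGS W p) hsst).mp (h W p hsst hL)

end Leaf

end Summit.BirchSwinnertonDyer.Rank1Residual.X11a

end
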